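import Summits.QuantumFields.BalabanUV.Beta.MultiscaleGradientCovariantStep
import Summits.QuantumFields.BalabanUV.Beta.ScaleBootstrap

/-!
# `Summit.QuantumFields.BalabanUV.Beta.MultiscaleGradientMemberCovariant` — THE GRADIENT MEMBER (3.42)₂'s SHAPE FOR `levelOp` WITH ARBITRARY
# COLUMN-ORTHONORMAL TRANSPORTS, MODULO (FG) ∧ (SF) AND THE SMALLNESS OF σ₁: `‖(D_R (levelOp)⁻¹u)(b,·)‖ ≤ 2|c₀|√|Cp|·T_cov·n(b₋)·e^{−δ d_n(b₋,t_{k′})}·m`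
# — ONE power of the local scale — the levelOp twin of the owner's 19b (`MultiscaleGradientMember`, FLAT transport) under road P3's reduction
# «rough-`Rm` gradient member ⇐ flat interior estimate (FG) + sup member + ONE (3.35)-shaped binder (SF)» (file B; claim «COVARIANT-FLAT-SPLIT»)

HONEST FRAMING (page 1 of everything in this cell).  Discharging `FlowStep.BetaPertH` would make Bałaban's ultraviolet
stability UNCONDITIONAL — a constructive-QFT result; it is NOT the continuum limit and NOT the Clay problem.  This module
discharges nothing of `BetaPertH`; it is [folklore] finite-dimensional bookkeeping about the MODEL operator, kernel-checked, by CO-OWNER #3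
of binder row D4 (unit `b2b-balaban-beta-d4-p3`, road P3 «reduction road», gen 13), in the OWNER's file-19b setting and letters.
HONEST DEPENDENCY: continuum YM on T⁴ ⇐ BetaPertH ∧ nine spine estimates (0/9 proved); BetaPertH ⇐ (D1) ∧ (D4) ∧ CAP+tail; G-an2-4
gates asym, D1 and NE2/3/4.

THE POINT (O.2 item (i-b) at MODEL level).  The owner's census E-an4-141d: for ROUGH isometric transports there is NO level-free pointwise
gradient member at MODEL level (ℤ₂ π-flux witness) — «(i-b) COVARIANT: FALSE level-free without (3.35)».  THIS FILE is the converse made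
precise: WITH the (3.35)-shaped binder (SF) («on every box of the assembly — centre `x₀`, natural radius `R = ⌊n(x₀)θ/4⌋` — there is a gauge in which
the transporters deviate from `1` by `≤ σ₁/(R+1)` near the box and vary along their own direction by `≤ σ₂/(R+1)²` on it») and the flat binder (FG) (co-owner beta-d4-p2's GR3 shape;
hypothesis-free at d = 4 by their adapter `FlatGradientBinderD4` over road P3's `GreenNewtonBoundD4`), the gradient member HOLDS for `levelOp`
with every column-orthonormal `Rm`, PROVIDED `σ₁` IS SMALL: `2dK₂σ₁√|Cp|·Γe^δ ≤ 1/2` — print's «Mα₀ ≤ a₀ sufficiently small» ([B9] Thm 3.1).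
PROOF: `ScaleBootstrap.bootstrap_of_local` over the finite index type of bonds `UT N × Fin d` with `X(b) = ‖(D_R f)(b)‖`,
`ω(b) = n(b₋)e^{−δ d_n(b₋,t_{k′})}`, neighbourhoods = the bonds starting in `{dist(·,b₋) ≤ 2R₀(b₋)+3}` in the good case (`∅` otherwise), growth
`Γe^δ` on them (19a `scale_le_on_unit_ball` + the `d_n`-triangle inequality, the box sitting in the `d_n`-ball of radius `1` by file A1's
`sdist_le_one_of_dist_le_box`), and the local inequality = file A3's `covariant_grad_local` with feedback `2dK₂σ₁√|Cp|`.
WHAT THIS IS NOT: not a bound on Bałaban's ∇_UG′(U); (FG), (SF) are hypothesis SHAPES ((3.35) p. 396 is a LOCATOR, not asserted; [B4] Lemma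
2.2's chain NOT reproduced); nothing printed enters as a fact; row D4 readiness width 0; D4 DISCHARGE NO DATE.

WHAT IS CERTIFIED (kernel, 0 sorry, 0 def): **`real_grad_levelOp_inverse_le_covariant`**; corollary `real_grad_levelOp_inverse_le_flat_of_covariant`
(flat transport: (SF) inhabited with `σ₁ = σ₂ = 0`, so the member holds modulo (FG) alone — consistency with 19b).  LOCATORS (shape only; ABSOLUTE RULE):
[Balaban1985BackgroundPropagators] (3.35) p. 396, Thm 3.1 (3.42) p. 397 («with Mα₀ ≤ a₀»), p. 398; [Balaban1983RegularityDecay] Lemma 2.2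
(2.17) pp. 577–578.  NOT BetaPertH, NOT continuum, NOT Clay, NOT summit progress.
-/
open scoped BigOperators
open Finset

namespace Summit.QuantumFields.BalabanUV.Beta.MultiscaleGradientMemberCovariant

open Summit.QuantumFields.BalabanUV.Beta.BoxPoincare (Box)
open Summit.QuantumFields.BalabanUV.Beta.MultiscaleCoerciveTorus
open Summit.QuantumFields.BalabanUV.Beta.MultiscaleDistance
open Summit.QuantumFields.BalabanUV.Beta.MultiscaleDistanceMetric (sdist_comm sdist_triangle_torus)
open Summit.QuantumFields.BalabanUV.Beta.MultiscaleDecayBudget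
open Summit.QuantumFields.BalabanUV.Beta.MultiscaleDecay (decay_levelOp)
open Summit.QuantumFields.BalabanUV.Beta.AccretiveCombesThomasSandwichSite (sdist_corner_thresholds)
open Summit.QuantumFields.BalabanUV.Beta.MultiscaleBoxDistance (sdist_le_of_dist_le)
open Summit.QuantumFields.BalabanUV.Beta.MultiscaleRegularityClosed (real_sup_levelOp_inverse_le)
open Summit.QuantumFields.BalabanUV.Beta.MultiscaleGradientSource (abs_le_on_unit_ball abs_levelSum_le_on_unit_ball)
open Summit.QuantumFields.BalabanUV.Beta.SubsolutionMeanValueBox (Cmv Cmv_pos)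
open Summit.QuantumFields.BalabanUV.Beta.CovariantKato (sqrt_sum_sq_add_le sqrt_sum_sq_smul sqrt_sum_sq_Rm)
open Summit.QuantumFields.BalabanUV.Beta.CovariantGradientBox (norm_le_sqrt_card_of_abs_le covariant_fdiff_le_box)
open Literature.MathematicalPhysics.QuantumFieldTheory.Balaban1983to89
open Literature.MathematicalPhysics.QuantumFieldTheory.Balaban1983to89.B9Thm37Glue (covD covDT covD_apply covDT_apply)
open Literature.MathematicalPhysics.QuantumFieldTheory.Balaban1983to89.B9Thm37GluePU (bsrc btgt bsrc_apply btgt_apply)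
open Literature.MathematicalPhysics.QuantumFieldTheory.Balaban1983to89.B9Thm37GlueTorusCov (tblk)
open Literature.MathematicalPhysics.QuantumFieldTheory.Balaban1983to89.B9Thm37GlueTorusCovLevels (levelOp levelSum)
open B5TorusCover (UT Ctr ctrU)
open B5Leibniz121 (up dn)


open Summit.QuantumFields.BalabanUV.Beta.MultiscaleGradientCovariantLocal (sdist_le_one_of_dist_le_box sf_binder_of_flat)
open Summit.QuantumFields.BalabanUV.Beta.MultiscaleGradientCovariantStep (covariant_grad_local)
open Summit.QuantumFields.BalabanUV.Beta.MultiscaleGradientSource (scale_le_on_unit_ball)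
open Summit.QuantumFields.BalabanUV.Beta.ScaleBootstrap (bootstrap_of_local)

noncomputable section

variable {d : ℕ} {N : Fin d → ℕ} [∀ i, NeZero (N i)]

section Main

variable [NeZero d] {Cp J K : Type} [Fintype Cp] [DecidableEq Cp] [Nonempty Cp]
  [Fintype J] [Fintype K] [DecidableEq K] (S : J → ℕ) (hS : ∀ l, 1 ≤ S l) (hdivS : ∀ l i, S l ∣ N i) (lvl : K → J)
  (zc : (k : K) → Ctr N (S (lvl k)))
  (hdisj : ∀ k k' v v', cellPt S hS hdivS lvl zc k v = cellPt S hS hdivS lvl zc k' v' → k = k')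
  (hcover : ∀ x : UT N, ∃ k, ∃ v : Box d (S (lvl k)), cellPt S hS hdivS lvl zc k v = x)
  (Rm : UT N × Fin d → Cp → Cp → ℝ) (hRm : ∀ b i j, ∑ k, Rm b k i * Rm b k j = if i = j then (1 : ℝ) else 0)
  (T : J → UT N → Cp → Cp → ℝ) (hT : ∀ l x i i', ∑ k, T l x k i * T l x k i' = if i = i' then (1 : ℝ) else 0)
  (a : J → ℝ) (ha : ∀ j, 0 ≤ a j) (ω : J → UT N → ℝ)
  (hsupp : ∀ l x, ω l (ctrU N (S l) (tblk (hS l) (hdivS l) x)) ≠ 0 → ∃ k v, lvl k = l ∧ cellPt S hS hdivS lvl zc k v = x)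
  {amax : ℝ} (hamax : 0 ≤ amax)
  (hscale : ∀ k, a (lvl k) * ω (lvl k) (ctrU N (S (lvl k)) (zc k)) ^ 2 * (S (lvl k) : ℝ) ^ d ≤ amax / (S (lvl k) : ℝ) ^ 2)
  (c : UT N × Fin d → ℝ) {c₀ : ℝ} (hcc : ∀ b, c b = c₀) (hc₀ : c₀ ≠ 0)
  {L : ℕ} (hL : 1 ≤ L) (e : J → ℕ) (hSe : ∀ l, S l = L ^ e l) {R : ℝ} (hR : 0 < R) {A : ℕ}
  (hadd : ∀ x y : UT N, |(e (lvl (cellOf S hS hdivS lvl zc hcover x)) : ℝ) - e (lvl (cellOf S hS hdivS lvl zc hcover y))| ≤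
    A + sdist bsrc btgt (siteScale S hS hdivS lvl zc hcover) x y / R)

include hdisj hT ha hsupp hamax hscale hL e hSe hR hadd hRm hcc hc₀

/-- **THE GRADIENT MEMBER (3.42)₂'s SHAPE FOR `levelOp` WITH ARBITRARY COLUMN-ORTHONORMAL TRANSPORTS, MODULO (FG) ∧ (SF) ∧ «σ₁ SMALL».**
In the MODEL setting of file 19b WITHOUT the flatness of `Rm`: the flat binder (FG) (`K₁, K₂ ≥ 0`), the (3.35)-SHAPED binder (SF)
(`σ₁, σ₂ ≥ 0`; gauges per box as in file A3) — both HYPOTHESES, ABSOLUTE RULE — and the smallness `2dK₂σ₁√|Cp|·Γe^δ ≤ 1/2`.  THEN for `u`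
supported in cell `k′` with `|u| ≤ m` and every bond `b`:
`‖(D_R (levelOp)⁻¹u)(b,·)‖ ≤ 2·|c₀|√|Cp|·T_cov·n(b₋)·e^{−δ·d_n(b₋,t_{k′})}·m`, `T_cov` as in file A3 — ONE power of the local scale; constants
seeing `d, c₀, c_max, a_max, C, κ, L, A, R, |Cp|, K₁, K₂, σ₁, σ₂` ONLY.  NOT a bound on Bałaban's ∇_UG′(U).
[cite: Balaban1985BackgroundPropagators, Thm 3.1 (3.42) p.397 + (3.35) p.396] [folklore] -/
theorem real_grad_levelOp_inverse_le_covariant {cmax : ℝ} (hc : ∀ b, |c b| ≤ cmax) {C : ℝ}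
    (hcoer : ∀ f : UT N × Cp → ℝ,
      C * ∑ k, ((S (lvl k) : ℝ) ^ 2)⁻¹ * ∑ v : Box d (S (lvl k)), ∑ i, f (cellPt S hS hdivS lvl zc k v, i) ^ 2 ≤
        ∑ p, f p * levelOp bsrc btgt c Rm (fun l x => ctrU N (S l) (tblk (hS l) (hdivS l) x))
          (fun l x => ω l (ctrU N (S l) (tblk (hS l) (hdivS l) x))) T a f p)
    {κ : ℝ} (hκ0 : 0 ≤ κ) (hκ1 : κ ≤ 1) (hμ : 0 < C - 2 * d * cmax ^ 2 * κ ^ 2 - amax * (Real.exp (2 * d * κ) - 1))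
    (hrate : (1 + d / 2) * (Real.log L / R) ≤ κ)
    {Γ θ δ 𝔅 : ℝ} (hΓ : Γ = (L : ℝ) ^ A * Real.exp (Real.log L / R * (4 * d + 1))) (hθ : θ = 1 / (4 * d * Γ))
    (hδ : δ = κ - (1 + d / 2) * (Real.log L / R))
    (h𝔅 : 𝔅 = (max (Real.sqrt (11 ^ d)) (Cmv d * Real.sqrt (21 ^ d)) / Real.sqrt (θ ^ d) +
            Real.sqrt (Fintype.card Cp) * (θ + 1) ^ 2 * (amax * Γ ^ 2 * Real.sqrt (Γ ^ d)) / (2 * c₀ ^ 2)) *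
          (Real.sqrt (Fintype.card Cp) * Real.exp (κ * ((4 * d + 1) + 2 * d)) *
            ((L : ℝ) ^ A * Real.exp (Real.log L / R * (4 * d + 1))) * (L : ℝ) ^ A * Real.sqrt (((L : ℝ) ^ A) ^ d) /
            (C - 2 * d * cmax ^ 2 * κ ^ 2 - amax * (Real.exp (2 * d * κ) - 1))) +
          Real.sqrt (Fintype.card Cp) * (θ + 1) ^ 2 / (2 * c₀ ^ 2) *
            Real.exp ((κ - (1 + d / 2) * (Real.log L / R)) * ((4 * d + 1) + 2 * d)))
    {K₁ K₂ : ℝ} (hK₁ : 0 ≤ K₁) (hK₂ : 0 ≤ K₂)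
    (hFG : ∀ (x₀ : UT N) (R : ℕ), 1 ≤ R → (∀ i, 10 * R + 4 ≤ N i) → ∀ (w : UT N → ℝ) (M G : ℝ),
      (∀ x ∈ univ.filter (fun x : UT N => dist x x₀ ≤ 2 * R + 2), |w x| ≤ M) →
      (∀ x ∈ univ.filter (fun x : UT N => dist x x₀ ≤ 2 * R + 2),
        |((∑ b ∈ univ.filter (fun b : UT N × Fin d => btgt b = x), c b ^ 2) +
              ∑ b ∈ univ.filter (fun b : UT N × Fin d => bsrc b = x), c b ^ 2) * w x -
            ((∑ b ∈ univ.filter (fun b : UT N × Fin d => btgt b = x), c b ^ 2 * w (bsrc b)) +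
              ∑ b ∈ univ.filter (fun b : UT N × Fin d => bsrc b = x), c b ^ 2 * w (btgt b))| ≤ G) →
      ∀ μ, |w (up x₀ μ) - w x₀| ≤ K₁ * M / ((R : ℝ) + 1) + K₂ * ((R : ℝ) + 1) * G / c₀ ^ 2)
    {σ₁ σ₂ : ℝ} (hσ₁ : 0 ≤ σ₁) (hσ₂ : 0 ≤ σ₂)
    (hSF : ∀ (x₀ : UT N) (R : ℕ), 1 ≤ R → (R : ℝ) ≤ (siteScale S hS hdivS lvl zc hcover x₀ : ℝ) * θ / 4 →
      (siteScale S hS hdivS lvl zc hcover x₀ : ℝ) * θ / 4 < R + 1 → ∃ g : UT N → Cp → Cp → ℝ, ∃ Rg : UT N × Fin d → Cp → Cp → ℝ,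
      (∀ x i j, ∑ k, g x k i * g x k j = if i = j then (1 : ℝ) else 0) ∧
      (∀ b i j, Rg b i j = ∑ k, g (bsrc b) i k * ∑ l, Rm b k l * g (btgt b) j l) ∧
      (∀ b : UT N × Fin d, dist (bsrc b) x₀ ≤ 2 * R + 3 → ∀ v : Cp → ℝ,
        Real.sqrt (∑ i, (∑ j, (Rg b i j - if i = j then (1 : ℝ) else 0) * v j) ^ 2) ≤
          σ₁ / ((R : ℝ) + 1) * Real.sqrt (∑ j, v j ^ 2)) ∧
      (∀ x ∈ univ.filter (fun x : UT N => dist x x₀ ≤ 2 * R + 2), ∀ μ (v : Cp → ℝ),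
        Real.sqrt (∑ i, (∑ j, (Rg (dn x μ, μ) i j - Rg (x, μ) i j) * v j) ^ 2) ≤
          σ₂ / ((R : ℝ) + 1) ^ 2 * Real.sqrt (∑ j, v j ^ 2)))
    (hsmall : 2 * d * K₂ * σ₁ * Real.sqrt (Fintype.card Cp) * (Γ * Real.exp δ) ≤ 1 / 2)
    (k' : K) (u : UT N × Cp → ℝ) (hu : ∀ p, cellOf S hS hdivS lvl zc hcover p.1 ≠ k' → u p = 0)
    {m : ℝ} (hm : 0 ≤ m) (hum : ∀ p, |u p| ≤ m) (b : UT N × Fin d) :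
    Real.sqrt (∑ i, covD bsrc btgt c Rm ((Ring.inverse (levelOp bsrc btgt c Rm (fun l x => ctrU N (S l) (tblk (hS l) (hdivS l) x))
        (fun l x => ω l (ctrU N (S l) (tblk (hS l) (hdivS l) x))) T a)) u) (b, i) ^ 2) ≤
      2 * (|c₀| * Real.sqrt (Fintype.card Cp) *
          (𝔅 * (Γ ^ 2 * Real.exp δ + 1) * (16 * d * Γ) + Real.sqrt (Fintype.card Cp) * K₁ * 𝔅 * Γ ^ 2 * Real.exp δ * (16 * d * Γ) +
            Real.sqrt (Fintype.card Cp) * K₂ * (θ / 4 + 1) *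
              (Real.exp (δ * (2 * d + 1)) + amax * Real.sqrt (Fintype.card Cp) * 𝔅 * Real.exp (δ * (4 * d + 1))) / c₀ ^ 2 +
            Real.sqrt (Fintype.card Cp) * K₂ * (d * (σ₂ + σ₁ ^ 2)) * 𝔅 * Γ ^ 2 * Real.exp δ * (16 * d * Γ) +
            σ₁ * 𝔅 * Γ ^ 2 * Real.exp δ * (16 * d * Γ))) *
        (siteScale S hS hdivS lvl zc hcover (bsrc b) : ℝ) *
        Real.exp (-(δ * sdist bsrc btgt (siteScale S hS hdivS lvl zc hcover) (bsrc b) (ctrU N (S (lvl k')) (zc k')))) * m := by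
  classical
  set f := (Ring.inverse (levelOp bsrc btgt c Rm (fun l x => ctrU N (S l) (tblk (hS l) (hdivS l) x))
        (fun l x => ω l (ctrU N (S l) (tblk (hS l) (hdivS l) x))) T a)) u with hf
  set n := siteScale S hS hdivS lvl zc hcover with hn
  set tk' : UT N := ctrU N (S (lvl k')) (zc k') with htk'
  set Tc := |c₀| * Real.sqrt (Fintype.card Cp) *
          (𝔅 * (Γ ^ 2 * Real.exp δ + 1) * (16 * d * Γ) + Real.sqrt (Fintype.card Cp) * K₁ * 𝔅 * Γ ^ 2 * Real.exp δ * (16 * d * Γ) +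
            Real.sqrt (Fintype.card Cp) * K₂ * (θ / 4 + 1) *
              (Real.exp (δ * (2 * d + 1)) + amax * Real.sqrt (Fintype.card Cp) * 𝔅 * Real.exp (δ * (4 * d + 1))) / c₀ ^ 2 +
            Real.sqrt (Fintype.card Cp) * K₂ * (d * (σ₂ + σ₁ ^ 2)) * 𝔅 * Γ ^ 2 * Real.exp δ * (16 * d * Γ) +
            σ₁ * 𝔅 * Γ ^ 2 * Real.exp δ * (16 * d * Γ)) with hTc
  -- positivity
  have hd1 : (1 : ℝ) ≤ d := by exact_mod_cast Nat.one_le_iff_ne_zero.mpr (NeZero.ne d)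
  have hd0 : (0 : ℝ) < d := by linarith
  have hL1 : (1 : ℝ) ≤ L := by exact_mod_cast hL
  have ht0 : 0 ≤ Real.log L / R := div_nonneg (Real.log_nonneg hL1) hR.le
  have hΓ1 : 1 ≤ Γ := by
    rw [hΓ]
    exact one_le_mul_of_one_le_of_one_le (one_le_pow₀ hL1) (Real.one_le_exp (mul_nonneg ht0 (by positivity)))
  have hΓ0 : 0 < Γ := by linarith
  have hθ0 : 0 < θ := by rw [hθ]; positivity
  have hδ0 : 0 ≤ δ := by rw [hδ]; linarith
  have hKc0 : 0 ≤ Real.sqrt (Fintype.card Cp) := Real.sqrt_nonneg _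
  have h𝔅0 : 0 ≤ 𝔅 := by rw [h𝔅]; positivity
  have hnpos : ∀ y, (0 : ℝ) < (n y : ℝ) := fun y => by exact_mod_cast one_le_siteScale S hS hdivS lvl zc hcover y
  have hTc0 : 0 ≤ Tc := by rw [hTc]; positivity
  -- the bootstrap data
  set X : UT N × Fin d → ℝ := fun b => Real.sqrt (∑ i, covD bsrc btgt c Rm f (b, i) ^ 2) with hX
  set wt : UT N × Fin d → ℝ := fun b => (n (bsrc b) : ℝ) * Real.exp (-(δ * sdist bsrc btgt n (bsrc b) tk')) with hwt
  set R₀ : UT N → ℕ := fun x => ⌊(n x : ℝ) * θ / 4⌋₊ with hR₀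
  set nb : UT N × Fin d → Finset (UT N × Fin d) := fun b =>
    if 1 ≤ R₀ (bsrc b) ∧ ∀ j, 10 * R₀ (bsrc b) + 4 ≤ N j then
      univ.filter (fun b' : UT N × Fin d => dist (bsrc b') (bsrc b) ≤ 2 * R₀ (bsrc b) + 3) else ∅ with hnb
  have hXn : ∀ b, 0 ≤ X b := fun b => Real.sqrt_nonneg _
  have hwt0 : ∀ b, 0 < wt b := fun b => mul_pos (hnpos _) (Real.exp_pos _)
  have hR₀le : ∀ x, (R₀ x : ℝ) ≤ n x * θ / 4 := fun x => Nat.floor_le (by have := (hnpos x).le; positivity)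
  have hR₀lt : ∀ x, (n x : ℝ) * θ / 4 < R₀ x + 1 := fun x => Nat.lt_floor_add_one _
  -- growth of the weight across a neighbourhood: `Γ·e^δ`
  have hgrowth : ∀ b, ∀ b' ∈ nb b, wt b' ≤ Γ * Real.exp δ * wt b := by
    intro b b' hb'
    by_cases hgood : 1 ≤ R₀ (bsrc b) ∧ ∀ j, 10 * R₀ (bsrc b) + 4 ≤ N j
    · have hnb_eq : nb b = univ.filter (fun b' : UT N × Fin d => dist (bsrc b') (bsrc b) ≤ 2 * R₀ (bsrc b) + 3) := by
        simp only [hnb]; exact if_pos hgood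
      have hmem : dist (bsrc b') (bsrc b) ≤ 2 * R₀ (bsrc b) + 3 := by
        rw [hnb_eq, mem_filter] at hb'
        exact hb'.2
      have hs : sdist bsrc btgt n (bsrc b') (bsrc b) ≤ 1 :=
        sdist_le_one_of_dist_le_box S hS hdivS lvl zc hcover hL e hSe hR hadd hΓ hθ (bsrc b) hgood.1 (hR₀le _) hmem
      have hsc : (n (bsrc b') : ℝ) ≤ Γ * n (bsrc b) := scale_le_on_unit_ball S hS hdivS lvl zc hcover hL e hSe hR hadd hΓ hs
      have htri : sdist bsrc btgt n (bsrc b) tk' ≤ sdist bsrc btgt n (bsrc b) (bsrc b') + sdist bsrc btgt n (bsrc b') tk' :=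
        sdist_triangle_torus n (bsrc b) (bsrc b') tk'
      have hsym : sdist bsrc btgt n (bsrc b) (bsrc b') = sdist bsrc btgt n (bsrc b') (bsrc b) := sdist_comm bsrc btgt n _ _
      have hexp : Real.exp (-(δ * sdist bsrc btgt n (bsrc b') tk')) ≤ Real.exp δ * Real.exp (-(δ * sdist bsrc btgt n (bsrc b) tk')) := by
        rw [← Real.exp_add]
        refine Real.exp_le_exp.mpr ?_
        have : δ * sdist bsrc btgt n (bsrc b) tk' ≤ δ * (1 + sdist bsrc btgt n (bsrc b') tk') :=
          mul_le_mul_of_nonneg_left (by linarith) hδ0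
        linarith
      calc wt b' = (n (bsrc b') : ℝ) * Real.exp (-(δ * sdist bsrc btgt n (bsrc b') tk')) := rfl
        _ ≤ (Γ * n (bsrc b)) * (Real.exp δ * Real.exp (-(δ * sdist bsrc btgt n (bsrc b) tk'))) :=
            mul_le_mul hsc hexp (Real.exp_pos _).le (by have := (hnpos (bsrc b)).le; positivity)
        _ = Γ * Real.exp δ * wt b := by simp only [hwt]; ring
    · have hnb_eq : nb b = ∅ := by simp only [hnb]; exact if_neg hgood
      rw [hnb_eq] at hb'
      exact absurd hb' (Finset.notMem_empty _)
  -- the local inequality (file A3) at every bond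
  have hloc : ∀ b (Y : ℝ), 0 ≤ Y → (∀ b' ∈ nb b, X b' ≤ Y) → X b ≤ Tc * m * wt b + 2 * d * K₂ * σ₁ * Real.sqrt (Fintype.card Cp) * Y := by
    intro b Y hY0 hYnb
    obtain ⟨x, μ⟩ := b
    have hY : (1 ≤ ⌊(n x : ℝ) * θ / 4⌋₊ ∧ ∀ j, 10 * ⌊(n x : ℝ) * θ / 4⌋₊ + 4 ≤ N j) →
        ∀ b' : UT N × Fin d, dist (bsrc b') x ≤ 2 * ⌊(n x : ℝ) * θ / 4⌋₊ + 3 →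
          Real.sqrt (∑ i, covD bsrc btgt c Rm f (b', i) ^ 2) ≤ Y := by
      intro hgood b' hb'
      have hgood' : 1 ≤ R₀ (bsrc (x, μ)) ∧ ∀ j, 10 * R₀ (bsrc (x, μ)) + 4 ≤ N j := by rw [bsrc_apply]; exact hgood
      have hnb_eq : nb (x, μ) = univ.filter (fun b' : UT N × Fin d => dist (bsrc b') (bsrc (x, μ)) ≤ 2 * R₀ (bsrc (x, μ)) + 3) := by
        simp only [hnb]; exact if_pos hgood'
      refine hYnb b' ?_
      rw [hnb_eq, mem_filter, bsrc_apply]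
      exact ⟨mem_univ _, hb'⟩
    have h := covariant_grad_local S hS hdivS lvl zc hdisj hcover Rm hRm T hT a ha ω hsupp hamax hscale c hcc hc₀ hL e hSe hR hadd
      hc hcoer hκ0 hκ1 hμ hrate hΓ hθ hδ h𝔅 hK₁ hK₂ hFG hσ₁ hσ₂ hSF k' u hu hm hum f hf x μ hY0 hY
    have e : Tc * m * wt (x, μ) = Tc * (n x : ℝ) * Real.exp (-(δ * sdist bsrc btgt n x tk')) * m := by
      simp only [hwt, bsrc_apply]; ring
    rw [e, hTc]
    exact h
  -- the bootstrap
  have hΓe0 : 0 ≤ Γ * Real.exp δ := by positivity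
  have hδΓ : 2 * d * K₂ * σ₁ * Real.sqrt (Fintype.card Cp) * (Γ * Real.exp δ) < 1 := lt_of_le_of_lt hsmall (by norm_num)
  have hboot := bootstrap_of_local X wt hXn hwt0 nb hΓe0 hgrowth hδΓ hloc b
  -- `A/(1 − δΓ) ≤ 2A`
  have hden : Tc * m / (1 - 2 * d * K₂ * σ₁ * Real.sqrt (Fintype.card Cp) * (Γ * Real.exp δ)) ≤ 2 * (Tc * m) := by
    have hq1 : 0 < 1 - 2 * d * K₂ * σ₁ * Real.sqrt (Fintype.card Cp) * (Γ * Real.exp δ) := sub_pos.mpr hδΓ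
    rw [div_le_iff₀ hq1]
    have hTm : 0 ≤ Tc * m := mul_nonneg hTc0 hm
    have h2 : Tc * m * (2 * d * K₂ * σ₁ * Real.sqrt (Fintype.card Cp) * (Γ * Real.exp δ)) ≤ Tc * m * (1 / 2) :=
      mul_le_mul_of_nonneg_left hsmall hTm
    have e : 2 * (Tc * m) * (1 - 2 * d * K₂ * σ₁ * Real.sqrt (Fintype.card Cp) * (Γ * Real.exp δ)) =
        2 * (Tc * m) - 2 * (Tc * m * (2 * d * K₂ * σ₁ * Real.sqrt (Fintype.card Cp) * (Γ * Real.exp δ))) := by ring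
    rw [e]
    linarith [h2]
  calc X b ≤ Tc * m / (1 - 2 * d * K₂ * σ₁ * Real.sqrt (Fintype.card Cp) * (Γ * Real.exp δ)) * wt b := hboot
    _ ≤ 2 * (Tc * m) * wt b := mul_le_mul_of_nonneg_right hden (hwt0 b).le
    _ = 2 * Tc * (n (bsrc b) : ℝ) * Real.exp (-(δ * sdist bsrc btgt n (bsrc b) tk')) * m := by simp only [hwt]; ring


/-- **COROLLARY (consistency with the owner's 19b): for the FLAT transport the covariant twin gives the gradient member MODULO (FG) ALONE**
— (SF) is inhabited by the identity gauge with `σ₁ = σ₂ = 0` (`MultiscaleGradientCovariantLocal.sf_binder_of_flat`) and the smallness is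
`0 ≤ 1/2`.  Same shape as `MultiscaleGradientMember.real_grad_levelOp_inverse_le_of_flatGradient` with a different constant (fibre norm instead
of a component; the zero terms are kept literally). [folklore] -/
theorem real_grad_levelOp_inverse_le_flat_of_covariant {cmax : ℝ} (hc : ∀ b, |c b| ≤ cmax) {C : ℝ}
    (hcoer : ∀ f : UT N × Cp → ℝ,
      C * ∑ k, ((S (lvl k) : ℝ) ^ 2)⁻¹ * ∑ v : Box d (S (lvl k)), ∑ i, f (cellPt S hS hdivS lvl zc k v, i) ^ 2 ≤
        ∑ p, f p * levelOp bsrc btgt c Rm (fun l x => ctrU N (S l) (tblk (hS l) (hdivS l) x))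
          (fun l x => ω l (ctrU N (S l) (tblk (hS l) (hdivS l) x))) T a f p)
    {κ : ℝ} (hκ0 : 0 ≤ κ) (hκ1 : κ ≤ 1) (hμ : 0 < C - 2 * d * cmax ^ 2 * κ ^ 2 - amax * (Real.exp (2 * d * κ) - 1))
    (hrate : (1 + d / 2) * (Real.log L / R) ≤ κ)
    {Γ θ δ 𝔅 : ℝ} (hΓ : Γ = (L : ℝ) ^ A * Real.exp (Real.log L / R * (4 * d + 1))) (hθ : θ = 1 / (4 * d * Γ))
    (hδ : δ = κ - (1 + d / 2) * (Real.log L / R))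
    (h𝔅 : 𝔅 = (max (Real.sqrt (11 ^ d)) (Cmv d * Real.sqrt (21 ^ d)) / Real.sqrt (θ ^ d) +
            Real.sqrt (Fintype.card Cp) * (θ + 1) ^ 2 * (amax * Γ ^ 2 * Real.sqrt (Γ ^ d)) / (2 * c₀ ^ 2)) *
          (Real.sqrt (Fintype.card Cp) * Real.exp (κ * ((4 * d + 1) + 2 * d)) *
            ((L : ℝ) ^ A * Real.exp (Real.log L / R * (4 * d + 1))) * (L : ℝ) ^ A * Real.sqrt (((L : ℝ) ^ A) ^ d) /
            (C - 2 * d * cmax ^ 2 * κ ^ 2 - amax * (Real.exp (2 * d * κ) - 1))) +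
          Real.sqrt (Fintype.card Cp) * (θ + 1) ^ 2 / (2 * c₀ ^ 2) *
            Real.exp ((κ - (1 + d / 2) * (Real.log L / R)) * ((4 * d + 1) + 2 * d)))
    {K₁ K₂ : ℝ} (hK₁ : 0 ≤ K₁) (hK₂ : 0 ≤ K₂)
    (hFG : ∀ (x₀ : UT N) (R : ℕ), 1 ≤ R → (∀ i, 10 * R + 4 ≤ N i) → ∀ (w : UT N → ℝ) (M G : ℝ),
      (∀ x ∈ univ.filter (fun x : UT N => dist x x₀ ≤ 2 * R + 2), |w x| ≤ M) →
      (∀ x ∈ univ.filter (fun x : UT N => dist x x₀ ≤ 2 * R + 2),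
        |((∑ b ∈ univ.filter (fun b : UT N × Fin d => btgt b = x), c b ^ 2) +
              ∑ b ∈ univ.filter (fun b : UT N × Fin d => bsrc b = x), c b ^ 2) * w x -
            ((∑ b ∈ univ.filter (fun b : UT N × Fin d => btgt b = x), c b ^ 2 * w (bsrc b)) +
              ∑ b ∈ univ.filter (fun b : UT N × Fin d => bsrc b = x), c b ^ 2 * w (btgt b))| ≤ G) →
      ∀ μ, |w (up x₀ μ) - w x₀| ≤ K₁ * M / ((R : ℝ) + 1) + K₂ * ((R : ℝ) + 1) * G / c₀ ^ 2)
    (hflat : ∀ b i j, Rm b i j = if i = j then (1 : ℝ) else 0)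
    (k' : K) (u : UT N × Cp → ℝ) (hu : ∀ p, cellOf S hS hdivS lvl zc hcover p.1 ≠ k' → u p = 0)
    {m : ℝ} (hm : 0 ≤ m) (hum : ∀ p, |u p| ≤ m) (b : UT N × Fin d) :
    Real.sqrt (∑ i, covD bsrc btgt c Rm ((Ring.inverse (levelOp bsrc btgt c Rm (fun l x => ctrU N (S l) (tblk (hS l) (hdivS l) x))
        (fun l x => ω l (ctrU N (S l) (tblk (hS l) (hdivS l) x))) T a)) u) (b, i) ^ 2) ≤
      2 * (|c₀| * Real.sqrt (Fintype.card Cp) *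
          (𝔅 * (Γ ^ 2 * Real.exp δ + 1) * (16 * d * Γ) + Real.sqrt (Fintype.card Cp) * K₁ * 𝔅 * Γ ^ 2 * Real.exp δ * (16 * d * Γ) +
            Real.sqrt (Fintype.card Cp) * K₂ * (θ / 4 + 1) *
              (Real.exp (δ * (2 * d + 1)) + amax * Real.sqrt (Fintype.card Cp) * 𝔅 * Real.exp (δ * (4 * d + 1))) / c₀ ^ 2 +
            Real.sqrt (Fintype.card Cp) * K₂ * (d * ((0 : ℝ) + (0 : ℝ) ^ 2)) * 𝔅 * Γ ^ 2 * Real.exp δ * (16 * d * Γ) +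
            (0 : ℝ) * 𝔅 * Γ ^ 2 * Real.exp δ * (16 * d * Γ))) *
        (siteScale S hS hdivS lvl zc hcover (bsrc b) : ℝ) *
        Real.exp (-(δ * sdist bsrc btgt (siteScale S hS hdivS lvl zc hcover) (bsrc b) (ctrU N (S (lvl k')) (zc k')))) * m :=
  real_grad_levelOp_inverse_le_covariant S hS hdivS lvl zc hdisj hcover Rm hRm T hT a ha ω hsupp hamax hscale c hcc hc₀ hL e hSe hR
    hadd hc hcoer hκ0 hκ1 hμ hrate hΓ hθ hδ h𝔅 hK₁ hK₂ hFG (le_refl (0 : ℝ)) (le_refl (0 : ℝ))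
    (sf_binder_of_flat S hS hdivS lvl zc hcover Rm hflat θ (le_refl (0 : ℝ)) (le_refl (0 : ℝ)))
    (by rw [mul_zero, zero_mul, zero_mul]; norm_num) k' u hu hm hum b

end Main

end

end Summit.QuantumFields.BalabanUV.Beta.MultiscaleGradientMemberCovariant
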